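import Literature.NumberTheory.LFunctions.AlternativeHypothesisLemma6UniformProofs
import HarnessLib

/-!
# BGSTB 2025, Lemma 6 (iii) WITH THE PRINTED ERROR TERMS — proved honestly (Corollary 5 on unequal
# windows + the smoothing sandwich); erratum E-ah-5 upgraded: printed display false, printed
# statement (iii) true

Topic `Literature/NumberTheory/LFunctions` (namespace `Literature.NumberTheory.LFunctions`; helpers and
cores in the sub-namespace `AH`). PROOF LAYER, theorems only (no definitions, no named facts), cell
`rh-crit/ah` (C5, seat t5 g5, row «Lem6(iii)-PRINTED»). LABEL: **NOT RH-BEARING** — every statement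
with zeta content is a CONDITIONAL with `RiemannHypothesis` as antecedent and the AH-Pairs data
`(M, R)` (`AH.IsPairsRate M R`) as hypothesis; §1 is pure real analysis. Nothing here bears on the
truth of RH or of AH.

S. A. C. Baluyot, D. A. Goldston, A. I. Suriajaya, C. L. Turnage-Butterbaugh, *The Alternative
Hypothesis for zeros of the Riemann zeta-function*, arXiv:2508.10857 (2025), UNREFEREED (D-0012);
TeX of record `rh-crit/ah/src/BGSTB2025_arXiv2508.10857.tex` (held text `paper:arxiv-2508.10857`):
§5 display (E_G) (TeX l. 819–820): "`E_G(λ, α) := 1/(λ²M) + (|α|+1)M²R(T) + 1/log T`, where `M`,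
`T`, and `R(T)` are from AH-Pairs"; **Lemma 5** [Heath-Brown] (l. 821–836; (ii) l. 826, (iv) l. 834);
**Corollary 5** (l. 839–841): "Assuming the Riemann Hypothesis and AH-Pairs, we have, for
`0 < λ ≤ 1/4`, `∫_{1−λ}^{1+λ} G_λ(α) dα = 2(P_0−1) + O(λ) + O(E_G(λ,1)) + O(1/(λ²√log T))`";
§6 **Lemma 6** (l. 928–954), (iii) (l. 938–941): "Let `K = 2L + 1` be an odd integer. Then for
`0 < λ ≤ 1/4` we have (iii) `∫_{K−λ}^{K+λ} F(β) dβ = 2(P_0 − 1) + O(λ) + O(E_G(λ², K))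
+ O(1/(λ⁴ √log T))`"; the printed proof of (iii)–(v) (l. 1007–1036), whose plan reads (l. 1007) "The
idea here is the average of `G_λ(α)` in the interval `(1−λ, 1+λ)` is just the unweighted average of
`F(α)` in `(1−2λ, 1+2λ)`".

## STATUS OF RECORD (cell `rh-crit/ah`)

E-ah-5 STANDS as typed in the kernel: `AH.bgstb2025_lemma6_printed_display_fails`
(`AlternativeHypothesisLemma6Proofs` §4, seat t5 g3) — the §6 display, third equality (TeX
l. 1012–1017), is false as printed (after the interchange `α` ranges over
`[1−λ, 1+λ] ∩ [w−λ, w+λ]`; `F ≡ 1`, `λ = 1/4` gives `1/2 ≠ 1`). THIS file proves the printed STATEMENT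
(iii) by a DIFFERENT route (OURS: Corollary 5 on unequal windows + the smoothing sandwich at
smoothing radius `μ = λ²` and windows `ν = λ ± λ²`), and M-uniformly
(`bgstb2025_lemma6_iii_printed_usplit`). So E-ah-5 is an erratum against the printed PROOF; the
printed statement (iii) is correct (in the corrected reading: "is just the unweighted average" ↦ "is
sandwiched between the unweighted averages over `(c−(ν−μ), c+(ν−μ))` and `(c−(ν+μ), c+(ν+μ))`").
The printed (v) (l. 952, pointwise `G_λ(K) = 2(P_0−1)/λ + O(1) + O(E_G(λ²,K)/λ) + O(1/(λ⁵√log T))`)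
is NOT proved honestly here (its upper half follows from (iii) since `λ G_λ(K) ≤ ∫_{K−λ}^{K+λ} F`;
its lower half does not follow by averaging (iii)). The typed claims `bgstb2025_lemma6`,
`bgstb2025_lemma6_v` are discharged AS TYPED elsewhere by the weakness of the typing (`∃ C` after
`∀ M`, `E_G ≥ 1/(μ²M)` absorbing the RH-bounded left sides: `bgstb2025_lemma6_holds`,
`bgstb2025_lemma6_v_holds`, `bgstb2025_lemma6_iii_asTyped`, `AlternativeHypothesisLemma6AsTyped`,
seat t2 g4, finding F-t2g4-1) — that discharge lends no support to the printed rate; this file does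
not use it. Before this file the sound two-sided (iii) of record had rate `λ^{2/3}`
(`bgstb2025_lemma6_iii_lower_odd` / `_upper_odd`, the upper half carrying a factor `1 + λ²/μ²` on the
main term, single tent majorant). LABEL: NOT RH-BEARING.

## What is proved here (OURS: a sound route to the PRINTED statement (iii))

* §1 (ζ-free) **the smoothing sandwich.** For the tent average `G_μ(α) = μ⁻² ∫_{−μ}^{μ} (μ − |β|)
  F(α + β) dβ` of a continuous `F ≥ 0` and a window of half-width `ν`:
  `∫_{c−ν}^{c+ν} G_μ(α) dα = μ⁻² ∫_{−μ}^{μ} (μ − |β|) (∫_{c−ν+β}^{c+ν+β} F) dβ`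
  (`AH.integral_heathBrownG_window_eq`, Fubini on the box), hence
  `∫_{c−(ν−μ)}^{c+(ν−μ)} F ≤ ∫_{c−ν}^{c+ν} G_μ ≤ ∫_{c−(ν+μ)}^{c+(ν+μ)} F`
  (`AH.integral_formFactor_le_integral_heathBrownG`, `AH.integral_heathBrownG_le_integral_formFactor`).
* §2 **Corollary 5 on unequal windows** (CORE form, inputs abstracted as in
  `AlternativeHypothesisLemma6UniformProofs` §C): for `0 < μ ≤ ν`, `μ ≤ 1/4`, `ν ≤ 1/2`,
  `|∫_{1−ν}^{1+ν} G_μ − 2(P₀ − 1)| ≤ (18|C₂| + 12|C₁| + 8)(ν + E_G(μ, 1) + 1/(μ² √log T))`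
  (`AH.corollary5_window_core`) — the landed Corollary 5 at radius `μ` (`AH.corollary5_core`) plus the
  two flanks `[1−ν, 1−μ]` (Lemma 5 (ii)) and `[1+μ, 1+ν]` (Lemma 5 (iv) `α ↦ α − 2`, evenness, (ii)),
  whose main terms `(ν−μ)(2−μ−ν)/2` each sum to at most `2ν`.
* §3 the transport `1 ↦ K = 2L + 1` at window `ν` (`AH.heathBrownG_window_transport_core`, cost
  `8|C₂| ν E_G(μ, K)`; the tree's `AH.heathBrownG_odd_transport_core` is the case `ν = μ`).
* §4 **Lemma 6 (iii) with the printed error terms, CORE form** (`AH.lemma6_iii_printed_core`): take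
  `μ = λ²`, `ν = λ ± λ²` in §§1–3 — two-sided
  `|∫_{K−λ}^{K+λ} F − 2(P₀ − 1)| ≤ (2|C_w| + |C_t|)(λ + E_G(λ², K) + 1/(λ⁴ √log T))`
  for all `0 < λ ≤ 1/4` and all odd `K`: the printed `E_G(λ², ·)` and `λ⁻⁴` are the smoothing scale
  `μ = λ²`, the printed `O(λ)` is the window excess.
* §5 instantiations: `bgstb2025_lemma6_iii_printed (hRH)` — conjunct 2 of the typed claim
  `bgstb2025_lemma6` VERBATIM (same binders), from the tree's `bgstb2025_lemma5_rh_holds`,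
  `bgstb2025_lemma5_ah_of_RH` (the AH half in the form §5 proves, E-ah-2) — NOT via the weak-as-typed
  absorption; `bgstb2025_lemma6_iii_printed_usplit (hRH)` — the same with SPLIT constants over the
  row-U uniform input `AH.exists_uniform_input` (`bgstb2025_lemma5_ah_usplit_errG`): ABSOLUTE
  `K₀, A` (quantified BEFORE the level `M`) in front of `λ + A/(λ⁴M) + 1/(λ⁴√log T)`, the
  level-dependent data entering only the `T`-vanishing `(|K|+1)(M/A)² R'(T) + 1/log T` with a positive
  rate `R'(T) → 0` — the M-UNIFORM content of the printed (iii); and the M-free form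
  `AH.window_odd_printedRate`: under RH and AH-Pairs, `|∫_{K−λ}^{K+λ} F − 2(P₀ − 1)| ≤ K₀ λ + ε` for
  all large `T`, every odd `K`, `0 < λ ≤ 1/4`, `ε > 0`, with ONE absolute `K₀` ("`= 2(P_0 − 1) + O(λ)
  + o(1)`").

## References

* [BaluyotGoldstonSuriajayaTurnageButterbaugh2025] arXiv:2508.10857, §5 (G_λ) (TeX l. 806), (E_G)
  (l. 819–820), Lemma 5 (l. 821–836), Corollary 5 (l. 839–841) and its proof (Cor5-1)–(Cor5-4)
  (l. 902–921); §6 Lemma 6 (l. 928–954), (iii) (l. 941), (v) (l. 952), (Hthm4)–(F-Hthm4)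
  (l. 960–966) and the printed proof of (iii)–(v) (l. 1007–1036; the display l. 1012–1017).
* Cell records: rh-crit/ah E-ah-5 (`AlternativeHypothesisLemma6Proofs` §4), row «U»
  (`AlternativeHypothesisFormFactorUniformProofs`, `AlternativeHypothesisLemma6UniformProofs`),
  F-t2g4-1 (`AlternativeHypothesisLemma6AsTyped`); ah/STATUS.md 2026-08-26T22:12:58Z (this row).
-/

noncomputable section

open scoped Real Topology
open Filter Set MeasureTheory

namespace Literature.NumberTheory.LFunctions

namespace AH

/-! ## §1. The smoothing sandwich (ζ-free: continuity and non-negativity of `F` only) -/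

/-- **Fubini for the window average of `G_μ`.** For `μ > 0`, `ν ≥ 0` and any centre `c`,
`∫_{c−ν}^{c+ν} G_μ(α, T) dα = μ⁻² ∫_{−μ}^{μ} (μ − |β|) (∫_{c−ν+β}^{c+ν+β} F(w, T) dw) dβ`
(`G_μ = AH.heathBrownG`, `F = montgomeryFormFactor`; the integrand `(μ − |β|) F(α + β)` is continuous on
the box `[c−ν, c+ν] × [−μ, μ]`). OURS (the sound form of the interchange the printed proof of
Lemma 6 (iii)–(v) attempts, p. 15). [cite: BaluyotGoldstonSuriajayaTurnageButterbaugh2025, §6 (proof of Lemma 6 (iii)–(v))] -/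
theorem integral_heathBrownG_window_eq {mu : ℝ} (hmu : 0 < mu) {nu : ℝ} (hnu : 0 ≤ nu) (c T : ℝ) :
    ∫ α in (c - nu)..(c + nu), heathBrownG mu α T =
      1 / mu ^ 2 * ∫ β in (-mu)..mu,
        (mu - |β|) * ∫ w in (c - nu + β)..(c + nu + β), montgomeryFormFactor w T := by
  have hF := RudnickSarnak.continuous_montgomeryFormFactor T
  unfold heathBrownG
  rw [intervalIntegral.integral_const_mul]
  congr 1
  -- swap the two integrations (continuous integrand on a compact box)
  have hswap : ∫ α in (c - nu)..(c + nu),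
        ∫ β in (-mu)..mu, (mu - |β|) * montgomeryFormFactor (α + β) T =
      ∫ β in (-mu)..mu,
        ∫ α in (c - nu)..(c + nu), (mu - |β|) * montgomeryFormFactor (α + β) T := by
    simp only [intervalIntegral.integral_of_le (by linarith : c - nu ≤ c + nu),
      intervalIntegral.integral_of_le (by linarith : -mu ≤ mu)]
    apply MeasureTheory.integral_integral_swap
    rw [Measure.prod_restrict]
    have hK : IsCompact (Icc (c - nu) (c + nu) ×ˢ Icc (-mu) mu) := isCompact_Icc.prod isCompact_Icc
    have hcont : Continuous fun p : ℝ × ℝ ↦ (mu - |p.2|) * montgomeryFormFactor (p.1 + p.2) T :=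
      (continuous_const.sub (continuous_snd.abs)).mul (hF.comp (continuous_fst.add continuous_snd))
    exact (hcont.continuousOn.integrableOn_compact hK).mono_set
      (Set.prod_mono Ioc_subset_Icc_self Ioc_subset_Icc_self)
  rw [hswap]
  refine intervalIntegral.integral_congr fun β _ ↦ ?_
  show (∫ α in (c - nu)..(c + nu), (mu - |β|) * montgomeryFormFactor (α + β) T) =
    (mu - |β|) * ∫ w in (c - nu + β)..(c + nu + β), montgomeryFormFactor w T
  rw [intervalIntegral.integral_const_mul,
    intervalIntegral.integral_comp_add_right (fun w ↦ montgomeryFormFactor w T) β]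

/-- `∫_{−μ}^{μ} (μ − |β|) dβ = μ²` (the mass of the tent `k_μ`). [cite: BaluyotGoldstonSuriajayaTurnageButterbaugh2025, §5 (k_λ)] -/
theorem integral_tent_eq_sq {mu : ℝ} (hmu : 0 < mu) : ∫ β in (-mu)..mu, (mu - |β|) = mu ^ 2 := by
  have h := integral_triangle_div_sq hmu
  rw [intervalIntegral.integral_div, div_eq_one_iff_eq (by positivity)] at h
  exact h

/-- **Smoothing sandwich, lower half**: for `0 < μ ≤ ν`, `T > 1` and any centre `c`,
`∫_{c−(ν−μ)}^{c+(ν−μ)} F ≤ ∫_{c−ν}^{c+ν} G_μ` — every shifted window `[c−ν+β, c+ν+β]`, `|β| ≤ μ`,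
contains `[c−(ν−μ), c+(ν−μ)]` and `F ≥ 0`. OURS. [cite: BaluyotGoldstonSuriajayaTurnageButterbaugh2025, §6 (F-Hthm4)] -/
theorem integral_formFactor_le_integral_heathBrownG {mu nu : ℝ} (hmu : 0 < mu) (hmn : mu ≤ nu)
    {T : ℝ} (hT : 1 < T) (c : ℝ) :
    ∫ w in (c - (nu - mu))..(c + (nu - mu)), montgomeryFormFactor w T ≤
      ∫ α in (c - nu)..(c + nu), heathBrownG mu α T := by
  have hF := RudnickSarnak.continuous_montgomeryFormFactor T
  have hF0 : ∀ w, 0 ≤ montgomeryFormFactor w T := fun w ↦ Montgomery.montgomeryFormFactor_nonneg w hT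
  have hFi : ∀ a b : ℝ, IntervalIntegrable (fun w ↦ montgomeryFormFactor w T) volume a b :=
    fun a b ↦ hF.intervalIntegrable a b
  rw [integral_heathBrownG_window_eq hmu (hmu.le.trans hmn) c T]
  set W0 : ℝ := ∫ w in (c - (nu - mu))..(c + (nu - mu)), montgomeryFormFactor w T with hW0
  set W : ℝ → ℝ := fun β ↦ ∫ w in (c - nu + β)..(c + nu + β), montgomeryFormFactor w T with hW
  -- each shifted window contains the inner window
  have hWge : ∀ β ∈ Icc (-mu) mu, W0 ≤ W β := by
    intro β hβ
    exact intervalIntegral.integral_mono_interval (by linarith [hβ.2]) (by linarith)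
      (by linarith [hβ.1]) (Eventually.of_forall fun w ↦ hF0 w) (hFi _ _)
  -- `W` is continuous (a window integral of a continuous function with moving endpoints)
  have hWc : Continuous W := by
    have hprim : Continuous fun x : ℝ ↦ ∫ w in (0 : ℝ)..x, montgomeryFormFactor w T :=
      intervalIntegral.continuous_primitive (fun a b ↦ hFi a b) 0
    have e : W = fun β ↦ (∫ w in (0 : ℝ)..(c + nu + β), montgomeryFormFactor w T) -
        ∫ w in (0 : ℝ)..(c - nu + β), montgomeryFormFactor w T := by
      funext β
      rw [hW]
      exact (intervalIntegral.integral_interval_sub_left (hFi _ _) (hFi _ _)).symm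
    rw [e]
    exact (hprim.comp (continuous_const.add continuous_id)).sub
      (hprim.comp (continuous_const.add continuous_id))
  have htent : Continuous fun β : ℝ ↦ mu - |β| := continuous_const.sub continuous_abs
  calc W0 = 1 / mu ^ 2 * ∫ β in (-mu)..mu, (mu - |β|) * W0 := by
        rw [intervalIntegral.integral_mul_const, integral_tent_eq_sq hmu]
        field_simp
    _ ≤ 1 / mu ^ 2 * ∫ β in (-mu)..mu, (mu - |β|) * W β := by
        refine mul_le_mul_of_nonneg_left ?_ (by positivity)
        refine intervalIntegral.integral_mono_on (by linarith)
          ((htent.mul continuous_const).intervalIntegrable _ _)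
          ((htent.mul hWc).intervalIntegrable _ _) fun β hβ ↦ ?_
        have hk : 0 ≤ mu - |β| := by
          have := abs_le.mpr ⟨hβ.1, hβ.2⟩; linarith
        exact mul_le_mul_of_nonneg_left (hWge β hβ) hk

/-- **Smoothing sandwich, upper half**: for `μ > 0`, `ν ≥ 0`, `T > 1` and any centre `c`,
`∫_{c−ν}^{c+ν} G_μ ≤ ∫_{c−(ν+μ)}^{c+(ν+μ)} F` — every shifted window `[c−ν+β, c+ν+β]`, `|β| ≤ μ`, is
contained in `[c−(ν+μ), c+(ν+μ)]` and `F ≥ 0` (the tree's `AH.integral_heathBrownG_le_window` is the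
case `ν = μ`). OURS. [cite: BaluyotGoldstonSuriajayaTurnageButterbaugh2025, §6 (F-Hthm4)] -/
theorem integral_heathBrownG_le_integral_formFactor {mu nu : ℝ} (hmu : 0 < mu) (hnu : 0 ≤ nu)
    {T : ℝ} (hT : 1 < T) (c : ℝ) :
    ∫ α in (c - nu)..(c + nu), heathBrownG mu α T ≤
      ∫ w in (c - (nu + mu))..(c + (nu + mu)), montgomeryFormFactor w T := by
  have hF := RudnickSarnak.continuous_montgomeryFormFactor T
  have hF0 : ∀ w, 0 ≤ montgomeryFormFactor w T := fun w ↦ Montgomery.montgomeryFormFactor_nonneg w hT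
  have hFi : ∀ a b : ℝ, IntervalIntegrable (fun w ↦ montgomeryFormFactor w T) volume a b :=
    fun a b ↦ hF.intervalIntegrable a b
  rw [integral_heathBrownG_window_eq hmu hnu c T]
  set W1 : ℝ := ∫ w in (c - (nu + mu))..(c + (nu + mu)), montgomeryFormFactor w T with hW1
  set W : ℝ → ℝ := fun β ↦ ∫ w in (c - nu + β)..(c + nu + β), montgomeryFormFactor w T with hW
  have hWle : ∀ β ∈ Icc (-mu) mu, W β ≤ W1 := by
    intro β hβ
    exact intervalIntegral.integral_mono_interval (by linarith [hβ.1]) (by linarith)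
      (by linarith [hβ.2]) (Eventually.of_forall fun w ↦ hF0 w) (hFi _ _)
  have hWc : Continuous W := by
    have hprim : Continuous fun x : ℝ ↦ ∫ w in (0 : ℝ)..x, montgomeryFormFactor w T :=
      intervalIntegral.continuous_primitive (fun a b ↦ hFi a b) 0
    have e : W = fun β ↦ (∫ w in (0 : ℝ)..(c + nu + β), montgomeryFormFactor w T) -
        ∫ w in (0 : ℝ)..(c - nu + β), montgomeryFormFactor w T := by
      funext β
      rw [hW]
      exact (intervalIntegral.integral_interval_sub_left (hFi _ _) (hFi _ _)).symm
    rw [e]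
    exact (hprim.comp (continuous_const.add continuous_id)).sub
      (hprim.comp (continuous_const.add continuous_id))
  have htent : Continuous fun β : ℝ ↦ mu - |β| := continuous_const.sub continuous_abs
  calc 1 / mu ^ 2 * ∫ β in (-mu)..mu, (mu - |β|) * W β
      ≤ 1 / mu ^ 2 * ∫ β in (-mu)..mu, (mu - |β|) * W1 := by
        refine mul_le_mul_of_nonneg_left ?_ (by positivity)
        refine intervalIntegral.integral_mono_on (by linarith)
          ((htent.mul hWc).intervalIntegrable _ _)
          ((htent.mul continuous_const).intervalIntegrable _ _) fun β hβ ↦ ?_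
        have hk : 0 ≤ mu - |β| := by
          have := abs_le.mpr ⟨hβ.1, hβ.2⟩; linarith
        exact mul_le_mul_of_nonneg_left (hWle β hβ) hk
    _ = W1 := by
        rw [intervalIntegral.integral_mul_const, integral_tent_eq_sq hmu]
        field_simp

/-- `E_G(μ, β)` is monotone in `|β|`: `E_G(μ, β) ≤ E_G(μ, β')` when `|β| ≤ |β'|`. [cite: BaluyotGoldstonSuriajayaTurnageButterbaugh2025, §5 (E_G)] -/
theorem errG_mono_abs {M RT T lam β β' : ℝ} (hRT : 0 ≤ RT) (h : |β| ≤ |β'|) :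
    errG M RT T lam β ≤ errG M RT T lam β' := by
  unfold errG
  have hMR : 0 ≤ M ^ 2 * RT := by positivity
  have : (|β| + 1) * M ^ 2 * RT ≤ (|β'| + 1) * M ^ 2 * RT := by
    rw [mul_assoc, mul_assoc]
    exact mul_le_mul_of_nonneg_right (by linarith) hMR
  linarith

/-! ## §2. Corollary 5 on unequal windows (CORE form) -/

set_option maxHeartbeats 400000 in
/-- **Corollary 5 on unequal windows, CORE form.** From Lemma 5 (i)–(ii) with constant `C₁` and the
AH half (iii)–(iv) in the shape `C₂ · E_G` at level `M'`, rate `R'`, bins at `Mb` (the hypotheses of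
`AH.corollary5_core`): for all large `T`, all `0 < μ ≤ ν` with `μ ≤ 1/4`, `ν ≤ 1/2`,
`|∫_{1−ν}^{1+ν} G_μ(α) dα − 2(P₀ − 1)| ≤ (18|C₂| + 12|C₁| + 8)(ν + E_G(μ, 1) + 1/(μ² √log T))`.
Route: `[1−ν, 1+ν] = [1−ν, 1−μ] ∪ [1−μ, 1+μ] ∪ [1+μ, 1+ν]`; the middle is Corollary 5 at radius `μ`
(`AH.corollary5_core`); on the left flank `G_μ(α) = α + O(C₁(1/√log T + 1/(μ² log T)))` (Lemma 5 (ii));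
on the right flank `G_μ(α) = G_μ(α − 2) + O(4C₂ E_G(μ,1)) = G_μ(2 − α) + … = (2 − α) + …`
(Lemma 5 (iv), evenness, (ii)); the two flank main terms are `(ν − μ)(2 − μ − ν)/2` each, together
`≤ 2ν`. OURS (the printed Corollary 5 is the case `ν = μ`).
[cite: BaluyotGoldstonSuriajayaTurnageButterbaugh2025, Corollary 5 (proof §5)] -/
theorem corollary5_window_core {C₁ C₂ Mb M' δ : ℝ} {R' : ℝ → ℝ} (hM' : 0 < M')
    (hR0 : ∀ T, 0 < R' T) (hδ1 : δ ≤ 1)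
    (h₁ : ∀ᶠ T : ℝ in atTop, ∀ lam : ℝ, 0 < lam → lam ≤ 1 / 2 → ∀ α : ℝ,
      (|α| < lam →
        |heathBrownG lam α T - (lam - |α|) / lam ^ 2| ≤
          C₁ * (lam + 1 / (lam * Real.sqrt (Real.log T)) + 1 / (lam ^ 2 * Real.log T))) ∧
      (lam ≤ |α| → |α| ≤ 1 - lam →
        abs (heathBrownG lam α T - |α|) ≤
          C₁ * (1 / Real.sqrt (Real.log T) + 1 / (lam ^ 2 * Real.log T))))
    (h₂ : ∀ᶠ T : ℝ in atTop, ∀ lam : ℝ, 0 < lam → lam ≤ 1 / 2 → ∀ α : ℝ,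
      ‖(heathBrownG lam α T : ℂ) -
          ∑' k : ℤ, Complex.exp (π * k * α * Complex.I) *
            ((Real.sinc (lam * π * k / 2) ^ 2 * binDensity k T Mb δ : ℝ) : ℂ)‖ ≤
        C₂ * errG M' (R' T) T lam α ∧
      ∀ L : ℤ, |heathBrownG lam (α + 2 * L) T - heathBrownG lam α T| ≤
        C₂ * errG M' (R' T) T lam (|α| + 2 * |(L : ℝ)|)) :
    ∀ᶠ T : ℝ in atTop, ∀ mu nu : ℝ, 0 < mu → mu ≤ nu → mu ≤ 1 / 4 → nu ≤ 1 / 2 →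
      |(∫ α in (1 - nu)..(1 + nu), heathBrownG mu α T) - 2 * (binDensity 0 T Mb δ - 1)| ≤
        (18 * |C₂| + 12 * |C₁| + 8) *
          (nu + errG M' (R' T) T mu 1 + 1 / (mu ^ 2 * Real.sqrt (Real.log T))) := by
  have h5 := corollary5_core hM' hR0 hδ1 h₁ h₂
  filter_upwards [h₁, h₂, h5, eventually_ge_atTop (3 : ℝ)] with T hT₁ hT₂ hT₅ hT3
  intro mu nu hmu hmn hmu4 hnu2
  have hT1 : (1 : ℝ) < T := by linarith
  have hmu2 : mu ≤ 1 / 2 := by linarith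
  have hmu1 : mu ≤ 1 := by linarith
  -- `log T ≥ 1`
  have hlog1 : 1 ≤ Real.log T := by
    rw [← Real.log_exp 1]
    exact Real.log_le_log (Real.exp_pos 1) (by have := Real.exp_one_lt_d9; linarith)
  have hlog0 : 0 < Real.log T := by linarith
  have hsq1 : 1 ≤ Real.sqrt (Real.log T) := by
    rw [show (1 : ℝ) = Real.sqrt 1 by simp]; exact Real.sqrt_le_sqrt hlog1
  have hsq0 : 0 < Real.sqrt (Real.log T) := by linarith
  have hsqle : Real.sqrt (Real.log T) ≤ Real.log T := by
    have h := Real.sq_sqrt hlog0.le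
    nlinarith
  -- notation
  set G : ℝ → ℝ := fun α ↦ heathBrownG mu α T with hG
  set E1 : ℝ := errG M' (R' T) T mu 1 with hE1
  set Q : ℝ := 1 / (mu ^ 2 * Real.sqrt (Real.log T)) with hQ
  set P0 : ℝ := binDensity 0 T Mb δ with hP0
  have hE10 : 0 ≤ E1 := by
    rw [hE1]; unfold errG
    have := hR0 T
    positivity
  have hQ0 : 0 ≤ Q := by positivity
  have hGc : Continuous G := continuous_heathBrownG mu T
  have hGi : ∀ a b : ℝ, IntervalIntegrable G volume a b := fun a b ↦ hGc.intervalIntegrable a b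
  have hab1 := hT₁ mu hmu hmu2
  have hab2 := hT₂ mu hmu hmu2
  -- `E_G(μ, α) ≤ (|α| + 1) E_G(μ, 1)`
  have hEle : ∀ α : ℝ, errG M' (R' T) T mu α ≤ (|α| + 1) * E1 := fun α ↦
    errG_le_mul_errG_one hM'.le (hR0 T).le hT1
  -- `e₂ := 1/√log T + 1/(μ² log T) ≤ 2Q`
  set e₂ : ℝ := 1 / Real.sqrt (Real.log T) + 1 / (mu ^ 2 * Real.log T) with he₂
  have he₂0 : 0 ≤ e₂ := by positivity
  have hQ1 : 1 / Real.sqrt (Real.log T) ≤ Q := by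
    rw [hQ]
    apply div_le_div_of_nonneg_left zero_le_one (by positivity)
    calc mu ^ 2 * Real.sqrt (Real.log T) ≤ 1 * Real.sqrt (Real.log T) := by
          gcongr; nlinarith
      _ = Real.sqrt (Real.log T) := one_mul _
  have hQ2 : 1 / (mu ^ 2 * Real.log T) ≤ Q := by
    rw [hQ]
    apply div_le_div_of_nonneg_left zero_le_one (by positivity)
    exact mul_le_mul_of_nonneg_left hsqle (by positivity)
  have he₂Q : e₂ ≤ 2 * Q := by rw [he₂]; linarith
  ---------------------------------------------------------------------------
  -- middle piece: Corollary 5 at radius `μ`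
  ---------------------------------------------------------------------------
  have hmid : |(∫ α in (1 - mu)..(1 + mu), G α) - 2 * (P0 - 1)| ≤
      (14 * |C₂| + 8 * |C₁| + 6) * (mu + E1 + Q) := hT₅ mu hmu hmu4
  ---------------------------------------------------------------------------
  -- left flank `[1 − ν, 1 − μ]`: `G(α) = α + O(C₁ e₂)`
  ---------------------------------------------------------------------------
  have hflank_pt : ∀ α : ℝ, 1 - nu ≤ α → α ≤ 1 - mu → |G α - α| ≤ |C₁| * e₂ := by
    intro α h1 h2
    have hα0 : 0 < α := by linarith
    have h := (hab1 α).2 (by rw [abs_of_pos hα0]; linarith) (by rw [abs_of_pos hα0]; exact h2)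
    rw [abs_of_pos hα0] at h
    exact h.trans (mul_le_mul_of_nonneg_right (le_abs_self _) he₂0)
  have hleft : |(∫ α in (1 - nu)..(1 - mu), G α) - (nu - mu) * (2 - mu - nu) / 2| ≤
      |C₁| * e₂ * (nu - mu) := by
    have hpt : ∀ α ∈ Set.uIoc (1 - nu) (1 - mu), ‖G α - α‖ ≤ |C₁| * e₂ := by
      intro α hα
      rw [Set.uIoc_of_le (by linarith)] at hα
      rw [Real.norm_eq_abs]
      exact hflank_pt α hα.1.le hα.2
    have hint := intervalIntegral.norm_integral_le_of_norm_le_const hpt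
    have hid' : IntervalIntegrable (fun x : ℝ ↦ x) volume (1 - nu) (1 - mu) :=
      (continuous_id : Continuous fun x : ℝ ↦ x).intervalIntegrable _ _
    rw [intervalIntegral.integral_sub (hGi _ _) hid', integral_id, Real.norm_eq_abs] at hint
    have e : ((1 - mu) ^ 2 - (1 - nu) ^ 2) / 2 = (nu - mu) * (2 - mu - nu) / 2 := by ring
    rw [e, show (1 : ℝ) - mu - (1 - nu) = nu - mu by ring,
      abs_of_nonneg (show (0 : ℝ) ≤ nu - mu by linarith)] at hint
    exact hint
  ---------------------------------------------------------------------------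
  -- right flank `[1 + μ, 1 + ν]`: `G(α) = G(α − 2) + O(4|C₂|E1) = G(2 − α) + … = (2 − α) + …`
  ---------------------------------------------------------------------------
  have hright_pt : ∀ α : ℝ, 1 + mu ≤ α → α ≤ 1 + nu →
      |G α - (2 - α)| ≤ |C₁| * e₂ + 4 * |C₂| * E1 := by
    intro α h1 h2
    -- periodicity, base point `β = α − 2`, `L = 1`
    have hper := (hab2 (α - 2)).2 1
    have eβ : α - 2 + 2 * ((1 : ℤ) : ℝ) = α := by push_cast; ring
    rw [eβ] at hper
    have hβabs : |α - 2| ≤ 1 := abs_le.mpr ⟨by linarith, by linarith⟩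
    have hE0 : 0 ≤ errG M' (R' T) T mu (|α - 2| + 2 * |((1 : ℤ) : ℝ)|) := by
      unfold errG; have := hR0 T; positivity
    have hper' : |G α - G (α - 2)| ≤ 4 * |C₂| * E1 := by
      calc |G α - G (α - 2)| ≤ C₂ * errG M' (R' T) T mu (|α - 2| + 2 * |((1 : ℤ) : ℝ)|) := hper
        _ ≤ |C₂| * errG M' (R' T) T mu (|α - 2| + 2 * |((1 : ℤ) : ℝ)|) :=
            mul_le_mul_of_nonneg_right (le_abs_self _) hE0
        _ ≤ |C₂| * ((|(|α - 2| + 2 * |((1 : ℤ) : ℝ)|)| + 1) * E1) :=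
            mul_le_mul_of_nonneg_left (hEle _) (abs_nonneg _)
        _ ≤ |C₂| * (4 * E1) := by
            gcongr
            have : |(|α - 2| + 2 * |((1 : ℤ) : ℝ)|)| = |α - 2| + 2 := by
              rw [abs_of_nonneg (by positivity)]; norm_num
            rw [this]; linarith
        _ = 4 * |C₂| * E1 := by ring
    -- evenness and Lemma 5 (ii) at `2 − α ∈ [1 − ν, 1 − μ]`
    have hev : G (α - 2) = G (2 - α) := by
      simp only [hG]
      rw [show α - 2 = -(2 - α) by ring]
      exact heathBrownG_neg mu (2 - α) T
    have hii : |G (2 - α) - (2 - α)| ≤ |C₁| * e₂ := hflank_pt (2 - α) (by linarith) (by linarith)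
    rw [hev] at hper'
    calc |G α - (2 - α)| = |(G α - G (2 - α)) + (G (2 - α) - (2 - α))| := by ring_nf
      _ ≤ |G α - G (2 - α)| + |G (2 - α) - (2 - α)| := abs_add_le _ _
      _ ≤ 4 * |C₂| * E1 + |C₁| * e₂ := add_le_add hper' hii
      _ = |C₁| * e₂ + 4 * |C₂| * E1 := by ring
  have hright : |(∫ α in (1 + mu)..(1 + nu), G α) - (nu - mu) * (2 - mu - nu) / 2| ≤
      (|C₁| * e₂ + 4 * |C₂| * E1) * (nu - mu) := by
    have hpt : ∀ α ∈ Set.uIoc (1 + mu) (1 + nu), ‖G α - (2 - α)‖ ≤ |C₁| * e₂ + 4 * |C₂| * E1 := by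
      intro α hα
      rw [Set.uIoc_of_le (by linarith)] at hα
      rw [Real.norm_eq_abs]
      exact hright_pt α hα.1.le hα.2
    have hint := intervalIntegral.norm_integral_le_of_norm_le_const hpt
    have hid' : IntervalIntegrable (fun x : ℝ ↦ 2 - x) volume (1 + mu) (1 + nu) :=
      (continuous_const.sub continuous_id : Continuous fun x : ℝ ↦ 2 - x).intervalIntegrable _ _
    rw [intervalIntegral.integral_sub (hGi _ _) hid', Real.norm_eq_abs] at hint
    have hlin : ∫ x in (1 + mu)..(1 + nu), (2 - x) = (nu - mu) * (2 - mu - nu) / 2 := by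
      have h1 : ∫ x in (1 + mu)..(1 + nu), (2 - x) =
          (∫ _x in (1 + mu)..(1 + nu), (2 : ℝ)) - ∫ x in (1 + mu)..(1 + nu), x :=
        intervalIntegral.integral_sub (continuous_const.intervalIntegrable _ _)
          (continuous_id.intervalIntegrable _ _)
      rw [h1, intervalIntegral.integral_const, integral_id]
      simp only [smul_eq_mul]
      ring
    rw [hlin, show (1 : ℝ) + nu - (1 + mu) = nu - mu by ring,
      abs_of_nonneg (show (0 : ℝ) ≤ nu - mu by linarith)] at hint
    exact hint
  ---------------------------------------------------------------------------
  -- assembly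
  ---------------------------------------------------------------------------
  have hsplit : (∫ α in (1 - nu)..(1 + nu), G α) =
      (∫ α in (1 - nu)..(1 - mu), G α) + (∫ α in (1 - mu)..(1 + mu), G α) +
        (∫ α in (1 + mu)..(1 + nu), G α) := by
    rw [intervalIntegral.integral_add_adjacent_intervals (hGi _ _) (hGi _ _),
      intervalIntegral.integral_add_adjacent_intervals (hGi _ _) (hGi _ _)]
  have hid : (∫ α in (1 - nu)..(1 + nu), G α) - 2 * (P0 - 1) =
      ((∫ α in (1 - mu)..(1 + mu), G α) - 2 * (P0 - 1)) +
        ((∫ α in (1 - nu)..(1 - mu), G α) - (nu - mu) * (2 - mu - nu) / 2) +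
        ((∫ α in (1 + mu)..(1 + nu), G α) - (nu - mu) * (2 - mu - nu) / 2) +
        (nu - mu) * (2 - mu - nu) := by
    rw [hsplit]; ring
  rw [hid]
  have b1 := abs_le.mp hmid
  have b2 := abs_le.mp hleft
  have b3 := abs_le.mp hright
  -- the flank main terms: `0 ≤ (ν − μ)(2 − μ − ν) ≤ 2ν`
  have hΦ0 : 0 ≤ (nu - mu) * (2 - mu - nu) := mul_nonneg (by linarith) (by linarith)
  have hΦ1 : (nu - mu) * (2 - mu - nu) ≤ 2 * nu := by nlinarith
  -- the flank errors
  have hfl : |C₁| * e₂ * (nu - mu) ≤ 2 * |C₁| * Q := by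
    have hA : 0 ≤ |C₁| := abs_nonneg _
    calc |C₁| * e₂ * (nu - mu) ≤ |C₁| * e₂ * 1 :=
          mul_le_mul_of_nonneg_left (by linarith) (by positivity)
      _ ≤ |C₁| * (2 * Q) * 1 := by gcongr
      _ = 2 * |C₁| * Q := by ring
  have hfr : (|C₁| * e₂ + 4 * |C₂| * E1) * (nu - mu) ≤ 2 * |C₁| * Q + 4 * |C₂| * E1 := by
    have hA : 0 ≤ |C₁| := abs_nonneg _
    have hB : 0 ≤ |C₂| := abs_nonneg _
    calc (|C₁| * e₂ + 4 * |C₂| * E1) * (nu - mu) ≤ (|C₁| * e₂ + 4 * |C₂| * E1) * 1 :=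
          mul_le_mul_of_nonneg_left (by linarith) (by positivity)
      _ ≤ (|C₁| * (2 * Q) + 4 * |C₂| * E1) * 1 := by gcongr
      _ = 2 * |C₁| * Q + 4 * |C₂| * E1 := by ring
  have hfin : (14 * |C₂| + 8 * |C₁| + 6) * (mu + E1 + Q) + 2 * |C₁| * Q +
      (2 * |C₁| * Q + 4 * |C₂| * E1) + 2 * nu ≤
      (18 * |C₂| + 12 * |C₁| + 8) * (nu + E1 + Q) := by
    have hA : 0 ≤ |C₁| := abs_nonneg _
    have hB : 0 ≤ |C₂| := abs_nonneg _
    have d : (18 * |C₂| + 12 * |C₁| + 8) * (nu + E1 + Q) -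
        ((14 * |C₂| + 8 * |C₁| + 6) * (mu + E1 + Q) + 2 * |C₁| * Q +
          (2 * |C₁| * Q + 4 * |C₂| * E1) + 2 * nu) =
        (14 * |C₂| + 8 * |C₁| + 6) * (nu - mu) + 4 * (|C₂| * nu) + 4 * (|C₁| * nu) +
          4 * (|C₁| * E1) + 4 * (|C₂| * Q) + 2 * E1 + 2 * Q := by ring
    have p0 : 0 ≤ (14 * |C₂| + 8 * |C₁| + 6) * (nu - mu) := mul_nonneg (by positivity) (by linarith)
    have p1 : 0 ≤ |C₂| * nu := mul_nonneg hB (by linarith)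
    have p2 : 0 ≤ |C₁| * nu := mul_nonneg hA (by linarith)
    have p3 : 0 ≤ |C₁| * E1 := mul_nonneg hA hE10
    have p4 : 0 ≤ |C₂| * Q := mul_nonneg hB hQ0
    linarith only [d, p0, p1, p2, p3, p4, hE10, hQ0]
  rw [abs_le]
  constructor <;>
    linarith only [b1.1, b1.2, b2.1, b2.2, b3.1, b3.2, hΦ0, hΦ1, hfl, hfr, hfin]

/-! ## §3. The transport `1 ↦ K = 2L + 1` at window `ν` -/

/-- **Transport of the window integral of `G_μ` from `1` to an odd centre `K = 2L + 1`, CORE form**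
(window half-width `ν` decoupled from the smoothing radius `μ`; the tree's
`AH.heathBrownG_odd_transport_core` is `ν = μ`): from the periodicity half of Lemma 5 with constant
`C₂` at level `M'`, rate `R'`, for all large `T`, all `0 < μ ≤ 1/2`, `0 ≤ ν ≤ 1`, all `L`,
`|∫_{K−ν}^{K+ν} G_μ − ∫_{1−ν}^{1+ν} G_μ| ≤ 8|C₂| ν E_G(μ, K)` (`E_G(μ, |α| + 2|L|) ≤ 4 E_G(μ, K)` for
`|α| ≤ 2`). [cite: BaluyotGoldstonSuriajayaTurnageButterbaugh2025, Lemma 5 (iv)] -/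
theorem heathBrownG_window_transport_core {C₂ M' : ℝ} {R' : ℝ → ℝ} (hM' : 0 < M')
    (hR0 : ∀ T, 0 < R' T)
    (h₂ : ∀ᶠ T : ℝ in atTop, ∀ lam : ℝ, 0 < lam → lam ≤ 1 / 2 → ∀ α : ℝ, ∀ L : ℤ,
      |heathBrownG lam (α + 2 * L) T - heathBrownG lam α T| ≤
        C₂ * errG M' (R' T) T lam (|α| + 2 * |(L : ℝ)|)) :
    ∀ᶠ T : ℝ in atTop, ∀ mu nu : ℝ, 0 < mu → mu ≤ 1 / 2 → 0 ≤ nu → nu ≤ 1 → ∀ L : ℤ,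
      |(∫ α in ((2 * L + 1 : ℝ) - nu)..((2 * L + 1 : ℝ) + nu), heathBrownG mu α T) -
          ∫ α in (1 - nu)..(1 + nu), heathBrownG mu α T| ≤
        8 * |C₂| * nu * errG M' (R' T) T mu (2 * L + 1) := by
  filter_upwards [h₂, eventually_gt_atTop (1 : ℝ)] with T hT hT1 mu nu hmu hmu2 hnu0 hnu1 L
  have hlog : 0 < Real.log T := Real.log_pos hT1
  have hRT : 0 < R' T := hR0 T
  have hGc : Continuous fun α : ℝ ↦ heathBrownG mu α T := continuous_heathBrownG mu T
  have hGc' : Continuous fun α : ℝ ↦ heathBrownG mu (α + 2 * L) T :=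
    hGc.comp (continuous_id.add continuous_const)
  -- shift the window at `K` back to the window at `1`
  have hshift : ∫ α in ((2 * L + 1 : ℝ) - nu)..((2 * L + 1 : ℝ) + nu), heathBrownG mu α T =
      ∫ α in (1 - nu)..(1 + nu), heathBrownG mu (α + 2 * L) T := by
    rw [intervalIntegral.integral_comp_add_right (fun α ↦ heathBrownG mu α T) (2 * (L : ℝ)),
      show (1 : ℝ) - nu + 2 * L = 2 * L + 1 - nu by ring,
      show (1 : ℝ) + nu + 2 * L = 2 * L + 1 + nu by ring]
  rw [hshift, ← intervalIntegral.integral_sub (hGc'.intervalIntegrable _ _)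
    (hGc.intervalIntegrable _ _)]
  have hK : 2 * |(L : ℝ)| ≤ |(2 * L + 1 : ℝ)| + 1 := by
    have h := abs_sub (2 * (L : ℝ) + 1) 1
    rw [add_sub_cancel_right, abs_mul, abs_two, abs_one] at h
    exact h
  have hbound : ∀ α ∈ Set.uIoc (1 - nu) (1 + nu),
      ‖heathBrownG mu (α + 2 * L) T - heathBrownG mu α T‖ ≤
        4 * |C₂| * errG M' (R' T) T mu (2 * L + 1) := by
    intro α hα
    rw [Set.uIoc_of_le (by linarith)] at hα
    have hα' : |α| ≤ 2 := abs_le.mpr ⟨by linarith [hα.1], by linarith [hα.2]⟩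
    have h1 := hT mu hmu hmu2 α L
    have hE0 : 0 ≤ errG M' (R' T) T mu (|α| + 2 * |(L : ℝ)|) := by
      simp only [errG]
      positivity
    have h2 : C₂ * errG M' (R' T) T mu (|α| + 2 * |(L : ℝ)|) ≤
        |C₂| * errG M' (R' T) T mu (|α| + 2 * |(L : ℝ)|) :=
      mul_le_mul_of_nonneg_right (le_abs_self _) hE0
    have h3 : errG M' (R' T) T mu (|α| + 2 * |(L : ℝ)|) ≤
        4 * errG M' (R' T) T mu (2 * L + 1) := by
      simp only [errG]
      rw [abs_of_nonneg (by positivity : (0 : ℝ) ≤ |α| + 2 * |(L : ℝ)|)]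
      have t1 : 1 / (mu ^ 2 * M') ≤ 4 * (1 / (mu ^ 2 * M')) := by
        have : 0 ≤ 1 / (mu ^ 2 * M') := by positivity
        linarith
      have t2 : (|α| + 2 * |(L : ℝ)| + 1) * M' ^ 2 * R' T ≤
          4 * ((|(2 * L + 1 : ℝ)| + 1) * M' ^ 2 * R' T) := by
        have hMR : 0 ≤ M' ^ 2 * R' T := by positivity
        have hcoef : |α| + 2 * |(L : ℝ)| + 1 ≤ 4 * (|(2 * L + 1 : ℝ)| + 1) := by
          have : 0 ≤ |(2 * L + 1 : ℝ)| := abs_nonneg _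
          linarith
        have := mul_le_mul_of_nonneg_right hcoef hMR
        linarith [this]
      have t3 : 1 / Real.log T ≤ 4 * (1 / Real.log T) := by
        have : 0 ≤ 1 / Real.log T := by positivity
        linarith
      linarith
    calc ‖heathBrownG mu (α + 2 * L) T - heathBrownG mu α T‖
        = |heathBrownG mu (α + 2 * L) T - heathBrownG mu α T| := Real.norm_eq_abs _
      _ ≤ C₂ * errG M' (R' T) T mu (|α| + 2 * |(L : ℝ)|) := h1
      _ ≤ |C₂| * errG M' (R' T) T mu (|α| + 2 * |(L : ℝ)|) := h2
      _ ≤ |C₂| * (4 * errG M' (R' T) T mu (2 * L + 1)) :=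
          mul_le_mul_of_nonneg_left h3 (abs_nonneg _)
      _ = 4 * |C₂| * errG M' (R' T) T mu (2 * L + 1) := by ring
  have h := intervalIntegral.norm_integral_le_of_norm_le_const hbound
  rw [Real.norm_eq_abs, show (1 : ℝ) + nu - (1 - nu) = 2 * nu by ring,
    abs_of_nonneg (by linarith : (0 : ℝ) ≤ 2 * nu)] at h
  calc |∫ α in (1 - nu)..(1 + nu), (heathBrownG mu (α + 2 * L) T - heathBrownG mu α T)|
      ≤ 4 * |C₂| * errG M' (R' T) T mu (2 * L + 1) * (2 * nu) := h
    _ = 8 * |C₂| * nu * errG M' (R' T) T mu (2 * L + 1) := by ring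

/-! ## §4. Lemma 6 (iii) with the printed error terms (CORE form) -/

/-- For an odd integer `K = 2L + 1`, `1 ≤ |K|` (as a real number). [folklore] -/
private theorem one_le_abs_two_mul_intCast_add_one (L : ℤ) : (1 : ℝ) ≤ |2 * (L : ℝ) + 1| := by
  have h : (2 * (L : ℝ) + 1) = ((2 * L + 1 : ℤ) : ℝ) := by push_cast; ring
  rw [h, ← Int.cast_abs]
  exact_mod_cast Int.one_le_abs (by omega : (2 * L + 1 : ℤ) ≠ 0)

set_option maxHeartbeats 400000 in
/-- **BGSTB 2025, Lemma 6 (iii) WITH THE PRINTED ERROR TERMS, CORE form.** From Corollary 5 on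
unequal windows (constant `C_w`, §2) and the transport (constant `C_t`, §3) at level `M'`, rate `R'`,
bins at `Mb`: for all large `T`, all `0 < λ ≤ 1/4` and all odd `K`,
`|∫_{K−λ}^{K+λ} F − 2(P₀ − 1)| ≤ (2|C_w| + |C_t|)(λ + E_G(λ², K) + 1/(λ⁴ √log T))`.
Route (OURS): smoothing radius `μ = λ²`, windows `ν = λ + λ²` (upper) and `ν = λ − λ²` (lower) in the
sandwich of §1; the printed `E_G(λ², ·)`, `λ⁻⁴` are the scale `μ = λ²`, the printed `O(λ)` is the
window excess `2ν ≤ 4λ`. Printed: "(iii) `∫_{K−λ}^{K+λ} F(β) dβ = 2(P_0 − 1) + O(λ) + O(E_G(λ², K))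
+ O(1/(λ⁴ √log T))`" (Lemma 6, p. 14) — the statement, not the printed proof (E-ah-5).
[cite: BaluyotGoldstonSuriajayaTurnageButterbaugh2025, Lemma 6 (iii)] -/
theorem lemma6_iii_printed_core {Cw Ct Mb M' δ : ℝ} {R' : ℝ → ℝ} (hM' : 0 < M')
    (hR0 : ∀ T, 0 < R' T)
    (hW : ∀ᶠ T : ℝ in atTop, ∀ mu nu : ℝ, 0 < mu → mu ≤ nu → mu ≤ 1 / 4 → nu ≤ 1 / 2 →
      |(∫ α in (1 - nu)..(1 + nu), heathBrownG mu α T) - 2 * (binDensity 0 T Mb δ - 1)| ≤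
        Cw * (nu + errG M' (R' T) T mu 1 + 1 / (mu ^ 2 * Real.sqrt (Real.log T))))
    (hTr : ∀ᶠ T : ℝ in atTop, ∀ mu nu : ℝ, 0 < mu → mu ≤ 1 / 2 → 0 ≤ nu → nu ≤ 1 → ∀ L : ℤ,
      |(∫ α in ((2 * L + 1 : ℝ) - nu)..((2 * L + 1 : ℝ) + nu), heathBrownG mu α T) -
          ∫ α in (1 - nu)..(1 + nu), heathBrownG mu α T| ≤
        Ct * nu * errG M' (R' T) T mu (2 * L + 1)) :
    ∀ᶠ T : ℝ in atTop, ∀ lam : ℝ, 0 < lam → lam ≤ 1 / 4 → ∀ K : ℤ, Odd K →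
      |(∫ β in (K - lam)..(K + lam), montgomeryFormFactor β T) - 2 * (binDensity 0 T Mb δ - 1)| ≤
        (2 * |Cw| + |Ct|) *
          (lam + errG M' (R' T) T (lam ^ 2) K + 1 / (lam ^ 4 * Real.sqrt (Real.log T))) := by
  filter_upwards [hW, hTr, eventually_gt_atTop (1 : ℝ)] with T hTW hTT hT1 lam hlam hlam4 K hK
  obtain ⟨L, rfl⟩ := hK
  push_cast
  have hlog : 0 < Real.log T := Real.log_pos hT1
  have hsq : 0 < Real.sqrt (Real.log T) := Real.sqrt_pos.mpr hlog
  have hRT : 0 < R' T := hR0 T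
  -- the scales: `μ = λ²`, `ν₊ = λ + λ²`, `ν₋ = λ − λ²`
  have hl2 : lam ^ 2 ≤ lam / 4 := by nlinarith
  have hmu : 0 < lam ^ 2 := by positivity
  have hmu4 : lam ^ 2 ≤ 1 / 4 := by nlinarith
  have hmu2 : lam ^ 2 ≤ 1 / 2 := by linarith
  have hmn_up : lam ^ 2 ≤ lam + lam ^ 2 := by linarith
  have hmn_lo : lam ^ 2 ≤ lam - lam ^ 2 := by linarith
  have hnup2 : lam + lam ^ 2 ≤ 1 / 2 := by linarith
  have hnum2 : lam - lam ^ 2 ≤ 1 / 2 := by linarith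
  have hnup0 : 0 ≤ lam + lam ^ 2 := by positivity
  have hnum0 : 0 ≤ lam - lam ^ 2 := by linarith
  have hnup1 : lam + lam ^ 2 ≤ 1 := by linarith
  have hnum1 : lam - lam ^ 2 ≤ 1 := by linarith
  -- notation for the error quantities
  set E : ℝ := errG M' (R' T) T (lam ^ 2) (2 * L + 1) with hE
  set E1 : ℝ := errG M' (R' T) T (lam ^ 2) 1 with hE1
  set Q : ℝ := 1 / (lam ^ 4 * Real.sqrt (Real.log T)) with hQ
  set P0 : ℝ := binDensity 0 T Mb δ with hP0
  have hE0 : 0 ≤ E := by rw [hE]; unfold errG; positivity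
  have hE10 : 0 ≤ E1 := by rw [hE1]; unfold errG; positivity
  have hQ0 : 0 ≤ Q := by positivity
  have hQe : 1 / ((lam ^ 2) ^ 2 * Real.sqrt (Real.log T)) = Q := by
    rw [hQ, show (lam ^ 2) ^ 2 = lam ^ 4 by ring]
  have hE1E : E1 ≤ E := by
    rw [hE1, hE]
    refine errG_mono_abs hRT.le ?_
    rw [abs_one]
    exact one_le_abs_two_mul_intCast_add_one L
  -- §1 sandwich at centre `K`
  have hS_up : (∫ β in (2 * (L : ℝ) + 1 - lam)..(2 * (L : ℝ) + 1 + lam), montgomeryFormFactor β T) ≤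
      ∫ α in (2 * (L : ℝ) + 1 - (lam + lam ^ 2))..(2 * (L : ℝ) + 1 + (lam + lam ^ 2)),
        heathBrownG (lam ^ 2) α T := by
    have h := integral_formFactor_le_integral_heathBrownG hmu hmn_up hT1 (2 * (L : ℝ) + 1)
    rw [show lam + lam ^ 2 - lam ^ 2 = lam by ring] at h
    exact h
  have hS_lo : (∫ α in (2 * (L : ℝ) + 1 - (lam - lam ^ 2))..(2 * (L : ℝ) + 1 + (lam - lam ^ 2)),
        heathBrownG (lam ^ 2) α T) ≤
      ∫ β in (2 * (L : ℝ) + 1 - lam)..(2 * (L : ℝ) + 1 + lam), montgomeryFormFactor β T := by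
    have h := integral_heathBrownG_le_integral_formFactor hmu hnum0 hT1 (2 * (L : ℝ) + 1)
    rw [show lam - lam ^ 2 + lam ^ 2 = lam by ring] at h
    exact h
  -- §3 transport and §2 window Corollary 5, at both windows
  have hT_up := hTT (lam ^ 2) (lam + lam ^ 2) hmu hmu2 hnup0 hnup1 L
  have hT_lo := hTT (lam ^ 2) (lam - lam ^ 2) hmu hmu2 hnum0 hnum1 L
  have hW_up := hTW (lam ^ 2) (lam + lam ^ 2) hmu hmn_up hmu4 hnup2
  have hW_lo := hTW (lam ^ 2) (lam - lam ^ 2) hmu hmn_lo hmu4 hnum2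
  rw [hQe] at hW_up hW_lo
  -- error bookkeeping
  have hCw0 : 0 ≤ |Cw| := abs_nonneg _
  have hCt0 : 0 ≤ |Ct| := abs_nonneg _
  have eW_up : Cw * (lam + lam ^ 2 + E1 + Q) ≤ 2 * |Cw| * (lam + E + Q) := by
    have h1 : Cw * (lam + lam ^ 2 + E1 + Q) ≤ |Cw| * (lam + lam ^ 2 + E1 + Q) :=
      mul_le_mul_of_nonneg_right (le_abs_self _) (by positivity)
    have h2 : lam + lam ^ 2 + E1 + Q ≤ 2 * (lam + E + Q) := by linarith
    nlinarith
  have eW_lo : Cw * (lam - lam ^ 2 + E1 + Q) ≤ |Cw| * (lam + E + Q) := by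
    have hx : 0 ≤ lam - lam ^ 2 + E1 + Q := by linarith
    have h1 : Cw * (lam - lam ^ 2 + E1 + Q) ≤ |Cw| * (lam - lam ^ 2 + E1 + Q) :=
      mul_le_mul_of_nonneg_right (le_abs_self _) hx
    have h2 : lam - lam ^ 2 + E1 + Q ≤ lam + E + Q := by linarith
    nlinarith
  have eT_up : Ct * (lam + lam ^ 2) * E ≤ |Ct| * (lam + E + Q) := by
    have h1 : Ct * (lam + lam ^ 2) * E ≤ |Ct| * (lam + lam ^ 2) * E := by
      have : 0 ≤ (lam + lam ^ 2) * E := by positivity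
      nlinarith [le_abs_self Ct]
    have h2 : |Ct| * (lam + lam ^ 2) * E ≤ |Ct| * 1 * E := by gcongr
    nlinarith
  have eT_lo : Ct * (lam - lam ^ 2) * E ≤ |Ct| * (lam + E + Q) := by
    have h1 : Ct * (lam - lam ^ 2) * E ≤ |Ct| * (lam - lam ^ 2) * E := by
      have : 0 ≤ (lam - lam ^ 2) * E := by positivity
      nlinarith [le_abs_self Ct]
    have h2 : |Ct| * (lam - lam ^ 2) * E ≤ |Ct| * 1 * E := by gcongr
    nlinarith
  have bW_up := abs_le.mp hW_up
  have bW_lo := abs_le.mp hW_lo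
  have bT_up := abs_le.mp hT_up
  have bT_lo := abs_le.mp hT_lo
  rw [abs_le]
  constructor
  · linarith [bW_lo.1, bT_lo.1, hS_lo, eW_lo, eT_lo]
  · linarith [bW_up.2, bT_up.2, hS_up, eW_up, eT_up]

end AH

/-! ## §5. Instantiations: the typed binders (honest constants), and the M-uniform split form -/

open AH in
/-- **BGSTB 2025, Lemma 6 (iii) with the printed error terms — conjunct (iii) of the typed claim
`bgstb2025_lemma6` VERBATIM, proved by the sound route of this file** (Corollary 5 on unequal
windows + smoothing sandwich at `μ = λ²`), from RH via the tree's Lemma 5 (i)–(ii)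
(`bgstb2025_lemma5_rh_holds`) and the AH half in the form §5 proves (`bgstb2025_lemma5_ah_of_RH`):
for AH-Pairs data `(M, R)` and a bin half-width `0 < δ ≤ 1/2` there is `C` with, for all large `T`,
all `0 < λ ≤ 1/4` and all odd `K`,
`|∫_{K−λ}^{K+λ} F(β, T) dβ − 2(P₀(T) − 1)| ≤ C(λ + E_G(λ², K) + 1/(λ⁴ √log T))`.
As a kernel STATEMENT this is implied by `bgstb2025_lemma6_iii_asTyped`
(`AlternativeHypothesisLemma6AsTyped`, seat t2 g4, weak-as-typed: `0 ≤ C`, every `K`); it is recorded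
because THIS proof avoids the `E_G`-absorption `E_G ≥ 1/(μ²M)` of that discharge — the constant here
is the cores' `2|C_w| + |C_t|`, inheriting the level dependence of the tree's
`bgstb2025_lemma5_ah_of_RH` only; the M-uniform content is `bgstb2025_lemma6_iii_printed_usplit`.
Printed: Lemma 6 (iii), p. 14 (quoted in the module docstring). Erratum E-ah-5 (cell rh-crit/ah)
concerns the printed PROOF; the printed STATEMENT (iii) is hereby a theorem.
[cite: BaluyotGoldstonSuriajayaTurnageButterbaugh2025, Lemma 6 (iii)] -/
theorem bgstb2025_lemma6_iii_printed (hRH : RiemannHypothesis) :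
    ∀ M : ℝ, 0 < M → ∀ R : ℝ → ℝ, AH.IsPairsRate M R → ∀ δ : ℝ, 0 < δ → δ ≤ 1 / 2 →
      ∃ C : ℝ, ∀ᶠ T : ℝ in atTop, ∀ lam : ℝ, 0 < lam → lam ≤ 1 / 4 → ∀ K : ℤ, Odd K →
        |(∫ β in (K - lam)..(K + lam), montgomeryFormFactor β T) -
            2 * (AH.binDensity 0 T M δ - 1)| ≤
          C * (lam + AH.errG M (R T) T (lam ^ 2) K + 1 / (lam ^ 4 * Real.sqrt (Real.log T))) := by
  intro M hM R hR δ hδ hδ2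
  obtain ⟨C₁, h₁⟩ := (bgstb2025_lemma5_rh_holds hRH).2
  obtain ⟨C₂, h₂⟩ := bgstb2025_lemma5_ah_of_RH hRH M hM R hR δ hδ hδ2
  have hR0 : ∀ T, 0 < R T := hR.1
  have hW := corollary5_window_core (Mb := M) hM hR0 (by linarith) h₁ h₂
  have hTr := heathBrownG_window_transport_core hM hR0
    (h₂.mono fun T hT lam hlam hlam2 α L ↦ (hT lam hlam hlam2 α).2 L)
  exact ⟨_, lemma6_iii_printed_core hM hR0 hW hTr⟩

/-- `1/log T → 0`. [folklore] -/
private theorem tendsto_one_div_log' : Tendsto (fun T : ℝ ↦ 1 / Real.log T) atTop (𝓝 0) := by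
  have h : Tendsto (fun T : ℝ ↦ (Real.log T)⁻¹) atTop (𝓝 0) :=
    Real.tendsto_log_atTop.inv_tendsto_atTop
  simpa [one_div] using h

/-- `c/√(log T) → 0`. [folklore] -/
private theorem tendsto_const_div_sqrt_log' (c : ℝ) :
    Tendsto (fun T : ℝ ↦ c / Real.sqrt (Real.log T)) atTop (𝓝 0) := by
  have h := ((Real.tendsto_sqrt_atTop.comp Real.tendsto_log_atTop).inv_tendsto_atTop).const_mul c
  rw [mul_zero] at h
  refine h.congr' (Eventually.of_forall fun T ↦ ?_)
  simp only [Pi.inv_apply, Function.comp_apply, div_eq_mul_inv]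

open AH in
/-- **BGSTB 2025, Lemma 6 (iii) with the printed error terms, SPLIT (M-uniform) constants.** Under
RH there are ABSOLUTE constants `K₀, A > 0` such that for every AH-Pairs level `M > 0` with
`AHPairsAt M` and every bin half-width `0 < δ ≤ 1/2` there is a positive rate `R'(T) → 0` with, for
all large `T`, all `0 < λ ≤ 1/4` and all odd `K`,
`|∫_{K−λ}^{K+λ} F − 2(P₀ − 1)| ≤ K₀(λ + A/(λ⁴M) + 1/(λ⁴√log T)) + K₀((|K|+1)(M/A)² R'(T) + 1/log T)`:
the level `M` enters the `T`-persistent part only through the printed `1/(λ⁴M)` (the `1/(λ²𝓜)` of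
`E_G(λ², K)` at `λ²`), with an absolute constant; the level-dependent data multiply `T`-vanishing
terms only. Inputs: `bgstb2025_lemma5_rh_holds`, the row-U uniform input `AH.exists_uniform_input`
(`bgstb2025_lemma5_ah_usplit_errG`), and the cores of §§2–4 fed with `C₂ = 1` at level `M/A`. OURS
(the M-uniform reading of the printed (iii); cell records G-ah-19 / R#115).
[cite: BaluyotGoldstonSuriajayaTurnageButterbaugh2025, Lemma 6 (iii)] -/
theorem bgstb2025_lemma6_iii_printed_usplit (hRH : RiemannHypothesis) :
    ∃ K₀ A : ℝ, 0 < K₀ ∧ 0 < A ∧ ∀ M : ℝ, 0 < M → AHPairsAt M → ∀ δ : ℝ, 0 < δ → δ ≤ 1 / 2 →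
      ∃ R' : ℝ → ℝ, (∀ T, 0 < R' T) ∧ Tendsto R' atTop (𝓝 0) ∧ ∀ᶠ T : ℝ in atTop,
        ∀ lam : ℝ, 0 < lam → lam ≤ 1 / 4 → ∀ K : ℤ, Odd K →
          |(∫ β in (K - lam)..(K + lam), montgomeryFormFactor β T) -
              2 * (AH.binDensity 0 T M δ - 1)| ≤
            K₀ * (lam + A / (lam ^ 4 * M) + 1 / (lam ^ 4 * Real.sqrt (Real.log T))) +
              K₀ * ((|(K : ℝ)| + 1) * (M / A) ^ 2 * R' T + 1 / Real.log T) := by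
  obtain ⟨C₁, h₁⟩ := (bgstb2025_lemma5_rh_holds hRH).2
  obtain ⟨A, hA, hU⟩ := AH.exists_uniform_input hRH
  obtain ⟨K₀, hK₀⟩ : ∃ K₀ : ℝ,
      K₀ = 2 * abs (18 * abs (1 : ℝ) + 12 * abs C₁ + 8) + abs (8 * abs (1 : ℝ)) := ⟨_, rfl⟩
  refine ⟨K₀, A, by rw [hK₀]; positivity, hA, ?_⟩
  intro M hM hAHM δ hδ hδ2
  obtain ⟨R', hR0, hRlim, h₂⟩ := hU M hM hAHM δ hδ hδ2
  refine ⟨R', hR0, hRlim, ?_⟩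
  have hM' : 0 < M / A := by positivity
  have hW := corollary5_window_core (C₂ := 1) (Mb := M) hM' hR0 (by linarith) h₁ h₂
  have hTr := heathBrownG_window_transport_core (C₂ := 1) hM' hR0
    (h₂.mono fun T hT lam hlam hlam2 α L ↦ (hT lam hlam hlam2 α).2 L)
  have hcore := lemma6_iii_printed_core hM' hR0 hW hTr
  filter_upwards [hcore] with T hT lam hlam hlam4 K hK
  have h := hT lam hlam hlam4 K hK
  rw [AH.errG_level_div hA.ne' hM.ne' (by positivity : lam ^ 2 ≠ 0)] at h
  rw [show (lam ^ 2) ^ 2 * M = lam ^ 4 * M by ring] at h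
  exact h.trans (le_of_eq (by rw [hK₀]; ring))

open AH in
/-- **The printed `O(λ)` rate, M-free form.** Assume RH and AH-Pairs. There is an ABSOLUTE `K₀ > 0`
such that for every bin half-width `0 < δ ≤ 1/2`, every bin parameter `M_b ≥ δ/2` (the diagonal bin
does not depend on it), every odd `K`, every `0 < λ ≤ 1/4` and every `ε > 0`, for all large `T`:
`|∫_{K−λ}^{K+λ} F(β, T) dβ − 2(P₀(T) − 1)| ≤ K₀ λ + ε` — i.e. "`∫_{K−λ}^{K+λ} F = 2(P_0 − 1) + O(λ)
+ o(1)` (`T → ∞`)" with an absolute `O`-constant, the level `M` of AH-Pairs having been sent to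
infinity inside the proof (`M ≥ 3K₀A/(λ⁴ε)`). OURS (the reading of the printed (iii) used in §7 of
the source, "we let `T → ∞` and then `M → ∞`", p. 16); compare the tree's `AH.window_odd_limit`
(same limit, no rate). [cite: BaluyotGoldstonSuriajayaTurnageButterbaugh2025, Lemma 6 (iii)] -/
theorem AH.window_odd_printedRate (hRH : RiemannHypothesis) (hAH : AHPairs) :
    ∃ K₀ : ℝ, 0 < K₀ ∧ ∀ δ : ℝ, 0 < δ → δ ≤ 1 / 2 → ∀ Mb : ℝ, δ / 2 ≤ Mb → ∀ K : ℤ, Odd K →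
      ∀ lam : ℝ, 0 < lam → lam ≤ 1 / 4 → ∀ ε : ℝ, 0 < ε → ∀ᶠ T : ℝ in atTop,
        |(∫ β in (K - lam)..(K + lam), montgomeryFormFactor β T) -
            2 * (AH.binDensity 0 T Mb δ - 1)| ≤ K₀ * lam + ε := by
  obtain ⟨K₀, A, hK₀, hA, h⟩ := bgstb2025_lemma6_iii_printed_usplit hRH
  refine ⟨K₀, hK₀, ?_⟩
  intro δ hδ hδ2 Mb hMb K hK lam hlam hlam4 ε hε
  -- the AH level: large enough to see the bin and to make `K₀ A/(λ⁴ M) ≤ ε/3`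
  obtain ⟨M, hM⟩ : ∃ M : ℝ, M = Mb + 1 + 3 * K₀ * A / (lam ^ 4 * ε) := ⟨_, rfl⟩
  have hM0 : 0 < M := by
    rw [hM]
    have : 0 ≤ 3 * K₀ * A / (lam ^ 4 * ε) := by positivity
    linarith
  have hMMb : Mb ≤ M := by
    rw [hM]
    have : 0 ≤ 3 * K₀ * A / (lam ^ 4 * ε) := by positivity
    linarith
  have hMA : K₀ * (A / (lam ^ 4 * M)) ≤ ε / 3 := by
    have hMge : 3 * K₀ * A / (lam ^ 4 * ε) ≤ M := by rw [hM]; linarith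
    rw [div_le_iff₀ (by positivity)] at hMge
    rw [mul_div_assoc', div_le_iff₀ (by positivity)]
    nlinarith
  obtain ⟨R', hR0, hRlim, hT⟩ := h M hM0 (hAH M hM0) δ hδ hδ2
  -- bin independence
  have hbin : ∀ T, AH.binDensity 0 T M δ = AH.binDensity 0 T Mb δ := fun T ↦
    AH.binDensity_eq_binDensity_of_le (k := 0) (by simp; linarith) (by simp; linarith)
  -- the `T`-vanishing part
  have hvan : Tendsto (fun T : ℝ ↦ K₀ * (1 / (lam ^ 4 * Real.sqrt (Real.log T))) +
      K₀ * ((|(K : ℝ)| + 1) * (M / A) ^ 2 * R' T + 1 / Real.log T)) atTop (𝓝 0) := by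
    have hs : Tendsto (fun T : ℝ ↦ 1 / (lam ^ 4 * Real.sqrt (Real.log T))) atTop (𝓝 0) := by
      have h := tendsto_const_div_sqrt_log' (1 / lam ^ 4)
      refine h.congr' (Eventually.of_forall fun T ↦ ?_)
      rw [div_div]
    have h := (hs.const_mul K₀).add
      (((hRlim.const_mul ((|(K : ℝ)| + 1) * (M / A) ^ 2)).add tendsto_one_div_log').const_mul K₀)
    simp only [mul_zero, add_zero] at h
    exact h
  filter_upwards [hT, hvan.eventually (gt_mem_nhds (show (0 : ℝ) < ε / 3 by positivity))]
    with T hTT hsmall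
  have hb := hTT lam hlam hlam4 K hK
  rw [hbin T] at hb
  have hsmall' : K₀ * (1 / (lam ^ 4 * Real.sqrt (Real.log T))) +
      K₀ * ((|(K : ℝ)| + 1) * (M / A) ^ 2 * R' T + 1 / Real.log T) < ε / 3 := hsmall
  have e : K₀ * (lam + A / (lam ^ 4 * M) + 1 / (lam ^ 4 * Real.sqrt (Real.log T))) +
      K₀ * ((|(K : ℝ)| + 1) * (M / A) ^ 2 * R' T + 1 / Real.log T) =
      K₀ * lam + K₀ * (A / (lam ^ 4 * M)) +
        (K₀ * (1 / (lam ^ 4 * Real.sqrt (Real.log T))) +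
          K₀ * ((|(K : ℝ)| + 1) * (M / A) ^ 2 * R' T + 1 / Real.log T)) := by ring
  linarith [hb, e.le, hMA, hsmall'.le]

end Literature.NumberTheory.LFunctions

end
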